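import Mathlib
import HarnessLib
import Summits.NavierStokesRegularity.NavierStokesRegularity.Theorems.QuarterLogPincerSmoothSilenceDefs
import Summits.NavierStokesRegularity.NavierStokesRegularity.Theorems.QuarterLogPincerTypeIQuantSubcubicExpFrameTools
import Summits.NavierStokesRegularity.NavierStokesRegularity.Theorems.QuarterLogPincerTypeIQuantSubcubicExpStubUniformScaledEnergy
import Literature.Analysis.FluidPDE.ESSLocalHolderNoConcentration
import Literature.Analysis.FluidPDE.EssCurry
import Literature.Analysis.FluidPDE.BackwardUniquenessRescale

/-!
# Route `QuarterLogPincer`, crux `TypeIQuantSubcubicExp` (stmt-NavierStokesRegularity-24077), line `smooth_silence` —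
# the line's PROVED KERNEL, by name: the UNCONDITIONAL exclusion of smooth vanishing witnesses, and the assembly

VERBATIM port (bodies byte-identical up to the unfolding of `E3`) of the sorry-free theorems of
`Cruxes/TypeIQuantSubcubicExp/Lines/smooth_silence.lean` v1.1: §W `enorm_sq_le_ofReal`, `lap_uncurry_c12`, ★
`no_smoothVanishingWitness : ¬ SmoothVanishingWitness` (UNCONDITIONAL, over the tree's proved Carleman chain
`Carleman.backwardUniqueness_uncurried_c12` / `uniqueContinuation_input_c12`), §K `driftStretchSilencingCost_of :
SmoothNormalisation → SmoothLimitStep → DriftStretchSilencingCost`, `sharpEnstrophyPersistence_of : VorticityTransport →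
DriftStretchSilencingCost → SharpEnstrophyPersistence`, `terminalEmber_of_sharp : SharpAftermath → VorticalCentre →
SharpEnstrophyPersistence → EmberReadout → TerminalEmber`.  NOT ported: the stubs, `terminalEmber_of_smooth_stubs`, and the
workfile's in-file proof `emberReadout_holds` of Sd (Sd is the tree theorem `SilencingCost.emberReadout` /
`SilencingCost.stub_emberReadout` on the imported `EmberReadout`, so nothing is restated).  HONEST FRAME: implications between Props
about HYPOTHETICAL objects plus one unconditional exclusion theorem for a smooth witness class; E2, the crux, W7 and Navier–Stokes
regularity stay OPEN (not proved).  pub-ns-dss typer (g38), `--supports stmt-NavierStokesRegularity-24077`; bodies by ns-idea-7 (g12).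
-/

set_option linter.dupNamespace false

namespace Summit.NavierStokesRegularity.NavierStokesRegularity.Cruxes.TypeIQuantSubcubicExp.SmoothSilence

noncomputable section

open MeasureTheory Set Function Filter Topology Metric
open scoped ENNReal NNReal Classical Laplacian InnerProductSpace RealInnerProductSpace
open Literature.Analysis Literature.Analysis.FluidPDE
open Summit.NavierStokesRegularity.NavierStokesRegularity.Theorems.ThinCascade
open Summit.NavierStokesRegularity.NavierStokesRegularity.Cruxes.TypeIQuantSubcubicExp.EmberCensus (Hot Terminal TerminalEmber)
open Summit.NavierStokesRegularity.NavierStokesRegularity.Cruxes.TypeIQuantSubcubicExp.SilencingCost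
  (BoxBound boxBound_mono VorticalCentre EmberReadout)

/-- `‖v‖ ≤ b ⇒ ‖v‖ₑ² ≤ ofReal (b²)`. -/
theorem enorm_sq_le_ofReal {V : Type*} [NormedAddCommGroup V] {v : V} {b : ℝ} (hv : ‖v‖ ≤ b) :
    ‖v‖ₑ ^ 2 ≤ ENNReal.ofReal (b ^ 2) := by
  have hb : 0 ≤ b := (norm_nonneg v).trans hv
  rw [← ofReal_norm, ← ENNReal.ofReal_pow (norm_nonneg _)]
  exact ENNReal.ofReal_le_ofReal (pow_le_pow_left₀ (norm_nonneg _) hv 2)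

/-- DICTIONARY (the `C¹₂` variant of the tree's `Carleman.lap_uncurry`, which asks joint `C²`): at a point of an
open set where the uncurried field is `C¹`, every slice-gradient map `(s,x) ↦ D(ω s)(x) e'` is differentiable
and the slice is `C²`, the frame Laplacian `Carleman.lap` of the uncurried field is Mathlib's Laplacian of the
slice. -/
theorem lap_uncurry_c12 {ω : ℝ → (EuclideanSpace ℝ (Fin 3)) → (EuclideanSpace ℝ (Fin 3))} {O : Set (ℝ × (EuclideanSpace ℝ (Fin 3)))} (hO : IsOpen O)
    {s : ℝ} {x : (EuclideanSpace ℝ (Fin 3))}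
    (hz : (s, x) ∈ O) (h1 : ContDiffOn ℝ 1 (uncurry ω) O)
    (hG : ∀ e' : (EuclideanSpace ℝ (Fin 3)),
      DifferentiableAt ℝ (fun z : ℝ × (EuclideanSpace ℝ (Fin 3)) => fderiv ℝ (ω z.1) z.2 e') (s, x))
    (h2 : ContDiff ℝ 2 (ω s)) :
    Carleman.lap (uncurry ω) (s, x) = (Δ (ω s)) x := by
  have hd : ∀ z ∈ O, DifferentiableAt ℝ (uncurry ω) z := fun z hz' =>
    (h1.differentiableOn one_ne_zero).differentiableAt (hO.mem_nhds hz')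
  have hdxdx : ∀ e e' : (EuclideanSpace ℝ (Fin 3)), Carleman.dx e (Carleman.dx e' (uncurry ω)) (s, x) =
      fderiv ℝ (fun y => fderiv ℝ (ω s) y e') x e := by
    intro e e'
    have hev : Carleman.dx e' (uncurry ω) =ᶠ[𝓝 ((s, x) : ℝ × (EuclideanSpace ℝ (Fin 3)))]
        fun z : ℝ × (EuclideanSpace ℝ (Fin 3)) => fderiv ℝ (ω z.1) z.2 e' := by
      filter_upwards [hO.mem_nhds hz] with z hz'
      obtain ⟨r, y⟩ := z
      exact Carleman.dx_uncurry (hd _ hz') e'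
    rw [Carleman.dx_apply, hev.fderiv_eq]
    exact Carleman.fderiv_apply_zero_eq_fderiv_slice (hG e') e
  rw [InnerProductSpace.laplacian_eq_iteratedFDeriv_stdOrthonormalBasis]
  simp only [Carleman.lap]
  refine Finset.sum_congr rfl fun i _ => ?_
  rw [hdxdx, iteratedFDeriv_two_apply]
  simp only [Matrix.cons_val_zero, Matrix.cons_val_one]
  have hd2 : DifferentiableAt ℝ (fderiv ℝ (ω s)) x :=
    ((h2.fderiv_right (m := 1) le_rfl).differentiable one_ne_zero).differentiableAt
  rw [fderiv_clm_apply hd2 (differentiableAt_const _)]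
  simp

/-- **KERNEL (stage 1, v1.1 — UNCONDITIONAL): the tree's PROVED ESS chain excludes `C¹₂` backward-vanishing
witnesses.**  Time reversal `u := U ∘ A`, `U = uncurry ω`, `A = stAffine (−1) 1 1 0 : (s,y) ↦ (1 − s, y)`, turns
the forward inequality into the backward one `|∂ₜu + Δu| ≤ B(|u| + |∇u|)` of Seregin 2014 Thm 3.5 / ESS 2003
Thm 5.1 on every `(0,1) × {0 < ⟪x,e⟫}`, with `u(0,·) = ω(1,·) = 0`, growth `|u| ≤ 1 = e^{0·|x|²}` and `∂ₜu`
bounded (so square integrable on bounded sets); the frame data (`Carleman.dt/dx/lap/gradSq`) are read off the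
slice data by the tree's dictionary (`Carleman.dt_uncurry`, `dx_uncurry`, `opNorm_fderiv_le_sqrt_gradSq`, and
`lap_uncurry_c12` above) and transported under `A` by the tree's chain rules (`Carleman.dt/lap/gradSq_comp_stAffine`,
`contDiffOn_comp_stAffine`, `contDiffOn_one_dx_comp_stAffine_c12`).  The tree's PROVED
`Carleman.backwardUniqueness_uncurried_c12` with the PROVED unique-continuation input
`uniqueContinuation_input_c12` (= `Carleman.uniqueContinuation_uncurried_c12 3 3`) gives `u ≡ 0` there, i.e.
`ω s x = 0` for `s ∈ (0,1)`, `x ≠ 0` (`e = x/‖x‖`); continuity finishes (`x = 0`, then `s = 0`), contradicting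
`ω(0,·) ≢ 0`.  NO literature fact is assumed. -/
theorem no_smoothVanishingWitness : ¬ SmoothVanishingWitness := by
  rintro ⟨B, ω, hB, hcont, hC1, hC12, hC2, hdiff, hsup, hbd, hineq, hend, x₀, hx₀⟩
  set U : ℝ × (EuclideanSpace ℝ (Fin 3)) → (EuclideanSpace ℝ (Fin 3)) := uncurry ω with hUdef
  set O : Set (ℝ × (EuclideanSpace ℝ (Fin 3))) := Ioo (0 : ℝ) 1 ×ˢ (univ : Set (EuclideanSpace ℝ (Fin 3))) with hOdef
  have hOo : IsOpen O := isOpen_Ioo.prod isOpen_univ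
  have hd : ∀ z ∈ O, DifferentiableAt ℝ U z := fun z hz =>
    (hC1.differentiableOn one_ne_zero).differentiableAt (hOo.mem_nhds hz)
  -- the `C¹₂` clause in the Carleman frame
  have hUx : ∀ e' : (EuclideanSpace ℝ (Fin 3)), ContDiffOn ℝ 1 (Carleman.dx e' U) O := by
    intro e'
    refine (hC12 e').congr ?_
    rintro ⟨r, y⟩ hz
    exact Carleman.dx_uncurry (hd _ hz) e'
  -- the dictionary on the open slab
  have hdtU : ∀ r ∈ Ioo (0 : ℝ) 1, ∀ y : (EuclideanSpace ℝ (Fin 3)), Carleman.dt U (r, y) = timeDeriv ω r y := fun r hr y =>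
    Carleman.dt_uncurry (hd (r, y) ⟨hr, mem_univ _⟩)
  have hlapU : ∀ r ∈ Ioo (0 : ℝ) 1, ∀ y : (EuclideanSpace ℝ (Fin 3)), Carleman.lap U (r, y) = (Δ (ω r)) y := by
    intro r hr y
    have hz : ((r, y) : ℝ × (EuclideanSpace ℝ (Fin 3))) ∈ O := ⟨hr, mem_univ _⟩
    exact lap_uncurry_c12 hOo hz hC1
      (fun e' => ((hC12 e').differentiableOn one_ne_zero).differentiableAt (hOo.mem_nhds hz)) (hC2 r hr)
  have hgradU : ∀ r ∈ Ioo (0 : ℝ) 1, ∀ y : (EuclideanSpace ℝ (Fin 3)),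
      ‖fderiv ℝ (ω r) y‖ ≤ Real.sqrt (Carleman.gradSq U (r, y)) := fun r hr y =>
    Carleman.opNorm_fderiv_le_sqrt_gradSq (hd (r, y) ⟨hr, mem_univ _⟩)
  -- ESS (tree, proved) on every half-space, after the time reversal `A (s, y) = (1 - s, y)`
  have hzero : ∀ e : (EuclideanSpace ℝ (Fin 3)), ‖e‖ = 1 → ∀ s ∈ Ioo (0 : ℝ) 1, ∀ y : (EuclideanSpace ℝ (Fin 3)), 0 < ⟪y, e⟫_ℝ → ω (1 - s) y = 0 := by
    intro e he
    set H : Set (EuclideanSpace ℝ (Fin 3)) := {x : (EuclideanSpace ℝ (Fin 3)) | 0 < ⟪x, e⟫_ℝ} with hH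
    set Q : Set (ℝ × (EuclideanSpace ℝ (Fin 3))) := Ioo (0 : ℝ) 1 ×ˢ H with hQ
    set A : ℝ × (EuclideanSpace ℝ (Fin 3)) → ℝ × (EuclideanSpace ℝ (Fin 3)) := stAffine (-1 : ℝ) 1 1 0 with hAdef
    have hA : ∀ z : ℝ × (EuclideanSpace ℝ (Fin 3)), A z = (1 - z.1, z.2) := by
      intro z
      rw [hAdef]
      refine Prod.ext ?_ ?_
      · show (1 : ℝ) + (-1) * z.1 = 1 - z.1
        ring
      · show (0 : (EuclideanSpace ℝ (Fin 3))) + (1 : ℝ) • z.2 = z.2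
        simp
    have hpre : Q ⊆ A ⁻¹' O := by
      intro z hz
      rw [mem_preimage, hA]
      exact ⟨⟨by linarith [hz.1.2], by linarith [hz.1.1]⟩, mem_univ _⟩
    have hrev : ∀ z ∈ Q, 1 - z.1 ∈ Ioo (0 : ℝ) 1 := fun z hz =>
      ⟨by linarith [hz.1.2], by linarith [hz.1.1]⟩
    -- the reversed field and its frame data
    set u : ℝ × (EuclideanSpace ℝ (Fin 3)) → (EuclideanSpace ℝ (Fin 3)) := fun z => U (A z) with hudef
    have hu1 : ContDiffOn ℝ 1 u Q := (Carleman.contDiffOn_comp_stAffine hC1 (-1) 1 1 0).mono hpre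
    have hux : ∀ e' : (EuclideanSpace ℝ (Fin 3)), ContDiffOn ℝ 1 (Carleman.dx e' u) Q := fun e' =>
      (Carleman.contDiffOn_one_dx_comp_stAffine_c12 (show (-1 : ℝ) ≠ 0 by norm_num) one_ne_zero
        hUx 1 0 e').mono hpre
    have hucont : ContinuousOn u (Ico (0 : ℝ) 1 ×ˢ H) := by
      refine Continuous.continuousOn ?_
      exact hcont.comp (continuous_stAffine (-1 : ℝ) 1 1 0)
    have h0 : ∀ y : (EuclideanSpace ℝ (Fin 3)), 0 < ⟪y, e⟫_ℝ → u (0, y) = 0 := by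
      intro y _
      show U (A (0, y)) = 0
      rw [hA]
      simp [hUdef, hend]
    have hdtu : ∀ z, Carleman.dt u z = (-1 : ℝ) • Carleman.dt U (A z) := fun z => by
      rw [hudef, Carleman.dt_comp_stAffine (show (-1 : ℝ) ≠ 0 by norm_num) one_ne_zero]
    have hlapu : ∀ z, Carleman.lap u z = Carleman.lap U (A z) := fun z => by
      rw [hudef, Carleman.lap_comp_stAffine (show (-1 : ℝ) ≠ 0 by norm_num) one_ne_zero, one_pow, one_smul]
    have hgradu : ∀ z, Carleman.gradSq u z = Carleman.gradSq U (A z) := fun z => by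
      rw [hudef, Carleman.gradSq_comp_stAffine (show (-1 : ℝ) ≠ 0 by norm_num) one_ne_zero, one_pow, one_mul]
    -- (hBH) the backward inequality
    have hBH : ∀ z ∈ Q, ‖Carleman.dt u z + Carleman.lap u z‖ ≤
        B * (‖u z‖ + Real.sqrt (Carleman.gradSq u z)) := by
      intro z hz
      have hs := hrev z hz
      rw [hdtu, hlapu, hgradu, show u z = U (A z) from rfl, hA, hdtU (1 - z.1) hs z.2,
        hlapU (1 - z.1) hs z.2]
      have e1 : (-1 : ℝ) • timeDeriv ω (1 - z.1) z.2 + Δ (ω (1 - z.1)) z.2 =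
          -(timeDeriv ω (1 - z.1) z.2 - Δ (ω (1 - z.1)) z.2) := by
        rw [neg_one_smul]; abel
      rw [e1, norm_neg]
      calc ‖timeDeriv ω (1 - z.1) z.2 - Δ (ω (1 - z.1)) z.2‖
          ≤ B * (‖ω (1 - z.1) z.2‖ + ‖fderiv ℝ (ω (1 - z.1)) z.2‖) := hineq _ hs _
        _ ≤ B * (‖U (1 - z.1, z.2)‖ + Real.sqrt (Carleman.gradSq U (1 - z.1, z.2))) :=
          mul_le_mul_of_nonneg_left (add_le_add (le_of_eq rfl) (hgradU _ hs _)) hB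
    -- (hgrowth) `|u| ≤ 1 = e^{0·|x|²}`
    have hgrowth : ∀ z ∈ Q, ‖u z‖ ≤ Real.exp (0 * ‖z.2‖ ^ 2) := by
      intro z _
      rw [zero_mul, Real.exp_zero, show u z = U (A z) from rfl, hA]
      exact hsup _ _
    -- (hH3) `∂ₜu` is bounded, hence square integrable on bounded sets
    have hH3 : ∀ K ⊆ Q, Bornology.IsBounded K → MeasurableSet K →
        ∫⁻ z in K, ‖Carleman.dt u z‖ₑ ^ 2 < ∞ := by
      intro K hK hKb hKm
      have hle : ∀ z ∈ K, ‖Carleman.dt u z‖ₑ ^ 2 ≤ ENNReal.ofReal (B ^ 2) := by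
        intro z hz
        have hs := hrev z (hK hz)
        rw [hdtu, hA, hdtU (1 - z.1) hs z.2, neg_one_smul, enorm_neg]
        exact enorm_sq_le_ofReal (hbd _ hs _).2.1
      calc ∫⁻ z in K, ‖Carleman.dt u z‖ₑ ^ 2 ≤ ∫⁻ _ in K, ENNReal.ofReal (B ^ 2) := setLIntegral_mono' hKm hle
        _ = ENNReal.ofReal (B ^ 2) * volume K := setLIntegral_const _ _
        _ < ∞ := ENNReal.mul_lt_top ENNReal.ofReal_lt_top hKb.measure_lt_top
    -- the tree's PROVED backward uniqueness in the class `C¹₂`, unique continuation PROVED in the tree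
    have hz0 := Carleman.backwardUniqueness_uncurried_c12 (E := (EuclideanSpace ℝ (Fin 3))) (F := (EuclideanSpace ℝ (Fin 3)))
      uniqueContinuation_input_c12 he (c₁ := B) (M := 0) hB le_rfl hu1 hux hucont h0 hBH hgrowth hH3
    intro s hs y hy
    have h : U (A (s, y)) = 0 := hz0 (s, y) ⟨hs, hy⟩
    rw [hA] at h
    simpa [hUdef] using h
  -- hence `ω s x = 0` for `s ∈ (0,1)` and `x ≠ 0`
  have hvan : ∀ s ∈ Ioo (0 : ℝ) 1, ∀ x : (EuclideanSpace ℝ (Fin 3)), x ≠ 0 → ω s x = 0 := by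
    intro s hs x hx
    have hnx : 0 < ‖x‖ := norm_pos_iff.2 hx
    set e : (EuclideanSpace ℝ (Fin 3)) := ‖x‖⁻¹ • x with he
    have hne : ‖e‖ = 1 := by
      rw [he, norm_smul, norm_inv, norm_norm, inv_mul_cancel₀ hnx.ne']
    have hxe : 0 < ⟪x, e⟫_ℝ := by
      rw [he, real_inner_smul_right, real_inner_self_eq_norm_sq]
      have : ‖x‖⁻¹ * ‖x‖ ^ 2 = ‖x‖ := by field_simp
      rw [this]; exact hnx
    have h := hzero e hne (1 - s) ⟨by linarith [hs.2], by linarith [hs.1]⟩ x hxe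
    simpa using h
  -- `x = 0` by spatial continuity
  have hvan' : ∀ s ∈ Ioo (0 : ℝ) 1, ∀ x : (EuclideanSpace ℝ (Fin 3)), ω s x = 0 := by
    intro s hs
    have hcs : Continuous (ω s) :=
      hcont.comp (continuous_const.prodMk continuous_id : Continuous fun x : (EuclideanSpace ℝ (Fin 3)) => (s, x))
    have hEq : (ω s) = fun _ => (0 : (EuclideanSpace ℝ (Fin 3))) := by
      refine Continuous.ext_on (dense_compl_singleton (0 : (EuclideanSpace ℝ (Fin 3)))) hcs continuous_const ?_
      intro x hx
      exact hvan s hs x hx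
    intro x
    simpa using congrFun hEq x
  -- `s = 0` by temporal continuity
  have hct : Continuous (fun r => ω r x₀) :=
    hcont.comp (continuous_id.prodMk continuous_const : Continuous fun r : ℝ => (r, x₀))
  have hclosed : IsClosed {r : ℝ | ω r x₀ = 0} := isClosed_eq hct continuous_const
  have hsub : Ioo (0 : ℝ) 1 ⊆ {r : ℝ | ω r x₀ = 0} := fun r hr => hvan' r hr x₀
  have h0 : (0 : ℝ) ∈ closure (Ioo (0 : ℝ) 1) := by
    rw [closure_Ioo (zero_ne_one' ℝ)]; exact ⟨le_rfl, zero_le_one⟩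
  have : (0 : ℝ) ∈ {r : ℝ | ω r x₀ = 0} := (hclosed.closure_subset_iff.2 hsub) h0
  exact hx₀ this

/-- KERNEL 1 (v1.1, unconditional): the drift–stretch silencing cost from normalisation + compactness + the
TREE'S PROVED ESS CHAIN (`no_smoothVanishingWitness`). -/
theorem driftStretchSilencingCost_of (h₁ : SmoothNormalisation) (h₂ : SmoothLimitStep) :
    DriftStretchSilencingCost := by
  by_contra h
  exact no_smoothVanishingWitness (h₂ (h₁ h))

/-- KERNEL 2 (glue): Sv♯ + Sc″ ⇒ Sc♯. -/
theorem sharpEnstrophyPersistence_of (hV : VorticityTransport) (hS : DriftStretchSilencingCost) :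
    SharpEnstrophyPersistence := by
  intro M₁ γ δ Γ₂ hM₁ hγ hδ hΓ₂
  obtain ⟨B, hB, hV⟩ := hV M₁ γ hM₁ hγ
  obtain ⟨K, c, hK, hc, hcδ, hS⟩ := hS B γ δ Γ₂ hB hγ hδ hΓ₂
  refine ⟨K, c, hK, hc, ?_⟩
  intro T u p hsol y σ t t₁ hσ ht0 htt₁ ht₁T hspan hbox hinit
  rcases eq_or_lt_of_le htt₁ with heq | hlt
  · subst heq
    calc ENNReal.ofReal (c / σ) ≤ ENNReal.ofReal (δ / σ) :=
          ENNReal.ofReal_le_ofReal (div_le_div_of_nonneg_right hcδ hσ.le)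
      _ ≤ ∫⁻ x in ball y (Γ₂ * σ), ‖curl (u t) x‖ₑ ^ 2 := hinit
      _ ≤ ∫⁻ x in ball y (K * σ), ‖curl (u t) x‖ₑ ^ 2 :=
          lintegral_mono_set (ball_subset_ball (mul_le_mul_of_nonneg_right hK hσ.le))
  · have hds := hV T u p hsol y σ (2 * K * σ) t t₁ hσ ht0 hlt ht₁T hbox
    exact hS (fun s => curl (u s)) u y σ t t₁ hσ hlt hspan hds hinit

/-- KERNEL 3: `SharpAftermath → VorticalCentre → SharpEnstrophyPersistence → EmberReadout → TerminalEmber`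
(the E2 kernel of `silencing_cost` run with the SHARP box; the tree's proved I1 feeds Sb's energy hypothesis
on the frame restricted to `[0,t]`; room factor `Λ := Γ₂²`, aperture `2K`, deposit `c'`). -/
theorem terminalEmber_of_sharp (hA : SharpAftermath) (hB : VorticalCentre)
    (hC : SharpEnstrophyPersistence) (hD : EmberReadout) : TerminalEmber := by
  obtain ⟨ε₀, hε₀, hA⟩ := hA
  refine ⟨ε₀, hε₀, fun ε M hε hεle hM => ?_⟩
  obtain ⟨M₁, γ, hM₁, hγ, hA⟩ := hA ε M hε hεle hM
  obtain ⟨C₀, hI⟩ :=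
    Summit.NavierStokesRegularity.NavierStokesRegularity.Cruxes.TypeIQuantSubcubicExp.ThinCascade.stub_uniformScaledEnergy
      M
  obtain ⟨Γ₂, δ, hΓ₂, hδ, hB⟩ := hB ε M₁ C₀ hε hM₁
  obtain ⟨K, c, hK, hc, hC⟩ := hC M₁ γ δ Γ₂ hM₁ hγ hδ hΓ₂
  have hK1 : 1 ≤ K := le_trans hΓ₂ hK
  obtain ⟨c', hc', hD⟩ := hD K M₁ c hK1 hM₁ hc
  refine ⟨2 * K, c', Γ₂ ^ 2, by linarith, hc', by nlinarith, ?_⟩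
  intro T τ u p hframe hτ htypeI t₁ y t ht₁ htt₁ hroom hhot hterm
  -- positivity of the clock and of the hot time
  have hTt : 0 < T + τ - t := by linarith [ht₁.2]
  have ht0 : 0 < t := by have h := hhot.1; linarith
  have htT : t ≤ T := le_trans htt₁ ht₁.2
  have htI : t ∈ Icc 0 T := ⟨ht0.le, htT⟩
  have ht₁I : t₁ ∈ Icc 0 T := ⟨ht₁.1.le, ht₁.2⟩
  have hσpos : 0 < Real.sqrt (T + τ - t) := Real.sqrt_pos.2 hTt
  have hσsq : Real.sqrt (T + τ - t) ^ 2 = T + τ - t := Real.sq_sqrt hTt.le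
  have hhot2 : ε < Real.sqrt (T + τ - t) * ‖u t y‖ := hhot.2
  -- (a♯) the sharp box of aperture `2K`
  have hbox4 := hA (2 * K) (by linarith) T τ u p hframe hτ htypeI t₁ y t ht₁ htt₁ hhot hterm
  generalize hσdef : Real.sqrt (T + τ - t) = σ at hσpos hσsq hhot2 hbox4 ⊢
  have hKσ : 0 < K * σ := mul_pos (by linarith) hσpos
  have hsharp : SharpBoxBound M₁ γ σ u y (Icc t t₁) (2 * K * σ) := sharpBoxBound_mono hbox4 (by nlinarith)
  have hbox : BoxBound M₁ σ u y (Icc t t₁) (2 * K * σ) := hsharp.boxBound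
  -- (b) I1 on the frame restricted to `[0,t]` gives the slice energy at radius `Γ₂σ`, then Sb
  have hframe_t := frame_restrict hframe ht0 htT
  have hτ' : 0 < T - t + τ := by linarith
  have hrate_t := typeI_restrict htypeI htT
  have hΓσ : 0 < Γ₂ * σ := mul_pos (by linarith) hσpos
  have hΓσ2 : (Γ₂ * σ) ^ 2 ≤ t := by
    have e : (Γ₂ * σ) ^ 2 = Γ₂ ^ 2 * (T + τ - t) := by rw [mul_pow, hσsq]
    rw [e]; exact hroom
  have hI1 := (hI t (T - t + τ) u p hframe_t hτ' hrate_t y (Γ₂ * σ) hΓσ hΓσ2).1 t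
    ⟨by nlinarith [sq_nonneg (Γ₂ * σ)], le_rfl⟩
  have hv2 : ContDiff ℝ 2 (u t) := (hframe.1.contDiff_velocity htI).of_le (WithTop.coe_le_coe.2 le_top)
  have hgrad : ∀ x ∈ ball y σ, ∀ j : ℕ, j ≤ 2 →
      ‖iteratedFDeriv ℝ j (u t) x‖ ≤ M₁ * σ ^ (-((j : ℝ) + 1)) :=
    fun x hx j hj => hbox t ⟨le_rfl, htt₁⟩ x (ball_subset_ball (by nlinarith) hx) j hj
  have hvort := hB (u t) y σ hσpos hv2 (hframe.1.divFree t htI) hgrad hI1 hhot2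
  -- (c♯) the linear lemma from `t` to `t₁`, sharp box
  have hspan : t₁ ≤ t + σ ^ 2 := by rw [hσsq]; linarith [ht₁.2]
  have hpers := hC T u p hframe.1 y σ t t₁ hσpos ht0.le htt₁ ht₁.2 hspan hsharp hvort
  -- (d) readout at `t₁`
  have hv2' : ContDiff ℝ 2 (u t₁) :=
    (hframe.1.contDiff_velocity ht₁I).of_le (WithTop.coe_le_coe.2 le_top)
  exact hD (u t₁) y σ hσpos hv2' (fun x hx j hj => hbox t₁ ⟨htt₁, le_rfl⟩ x hx j hj) hpers

end

end Summit.NavierStokesRegularity.NavierStokesRegularity.Cruxes.TypeIQuantSubcubicExp.SmoothSilence
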